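import Mathlib
import Literature.Computability.AlgebraicComplexity.GroupTheoreticMatMul
import Summits.MatrixMultiplication.MatrixMultiplication.Theorems.AbelianSTPPCensusExistenceDesigns

/-!
# Every cyclic group of order `n ≥ 3abc` hosts an STPP pair of shapes `(a,b,c), (a,b,c)` (cell mm-stpp, eng-1 g7)

The TRANSLATE DESIGN in a cyclic group, for all parameters: in `ℤ/n` let `A = {0,…,a−1}`,
`B = a·{0,…,b−1}`, `C = ab·{0,…,c−1}` (a mixed-radix box, `A + B + C = {0,…,abc−1}` with all sums
distinct), and put `V = abc`.  If `n ≥ 3V` then the two triples `(A, B, C)` and `(A, B + V, C + 2V)` form an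
`IsSTPP` family (`isSTPP_cyclicTranslatePair`); hence `ℤ/n` hosts an STPP pair of shapes `(a,b,c), (a,b,c)`
(`exists_isSTPP_pair_zmod`), in particular an `(s,s,s)²` pair whenever `n ≥ 3s³`
(`exists_isSTPP_cube_pair_zmod`).  Proof: the difference set `(A−A)+(B−B)+(C−C)` consists of the residues of
the integers of absolute value `< V`, and the six cross patterns of CKSU Def. 5.1 (ii) shift it by `±V` or
`±2V`, which never reaches `0 (mod n)` when `n ≥ 3V` — an instance of the labelled-translates criterion
`STPPExistenceDesigns.isSTPP_translates` (this seat, g6), whose only previous kernel instance was `(2,2,2)²`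
at `n = 24`.

Context (the cell's existence table, R-5 (Q-i)): this is the constructive half of the observation that a
CYCLIC group hosts a pair of two `(s,s,s)` cubes from order `3s³` on; the cell's exact engine finds NO
`(s,s,s)²` pair in any cyclic group of order `< 3s³` for `s ≤ 3` (s = 3: `ℤ/64, …, ℤ/79` decided one by one),
whereas non-cyclic groups host the CKSU pair at `(s+1)³ < 3s³` for `s ≥ 3`.
WHAT THIS IS NOT: a THIN design (`2V ≤ n`; density `1/3`); no `ω` statement; no census number.
-/

-- single-conjunct summit: the mandated namespace repeats `MatrixMultiplication`.
set_option linter.dupNamespace false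

namespace Summit.MatrixMultiplication.MatrixMultiplication.Theorems.STPPCyclicTranslatePair

open Finset
open Literature.Computability.AlgebraicComplexity (IsSTPP)
open scoped Pointwise

/-! ## The mixed-radix box in `ℤ/n` -/

/-! Notation used in the statements below (no definitions are introduced, so that the file is a pure
proof file): `A = (range a).image (x ↦ (x : ZMod n))`, `B = (range b).image (y ↦ ((a*y : ℕ) : ZMod n))`,
`C = (range c).image (z ↦ ((a*b*z : ℕ) : ZMod n))`, labels `![0, V]` on `B` and `![0, 2V]` on `C`,
`V = ((a*b*c : ℕ) : ZMod n)`. -/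

/-- Mixed-radix bound: for digits `x, x' < a`, `y, y' < b`, `z, z' < c` the integer
`(x − x') + a(y − y') + ab(z − z')` has absolute value `< abc`. [bookkeeping] -/
theorem abs_mixedRadix_lt {a b c x x' y y' z z' : ℤ} (hx : 0 ≤ x) (hxa : x < a) (hx' : 0 ≤ x')
    (hxa' : x' < a) (hy : 0 ≤ y) (hyb : y < b) (hy' : 0 ≤ y') (hyb' : y' < b) (hz : 0 ≤ z) (hzc : z < c)
    (hz' : 0 ≤ z') (hzc' : z' < c) :
    |(x - x') + a * (y - y') + a * b * (z - z')| < a * b * c := by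
  have ha : 0 ≤ a := le_trans hx hxa.le
  have hb : 0 ≤ b := le_trans hy hyb.le
  have hab : 0 ≤ a * b := mul_nonneg ha hb
  have h1 : a * (y - y') ≤ a * (b - 1) := mul_le_mul_of_nonneg_left (by omega) ha
  have h2 : a * (y' - y) ≤ a * (b - 1) := mul_le_mul_of_nonneg_left (by omega) ha
  have h3 : a * b * (z - z') ≤ a * b * (c - 1) := mul_le_mul_of_nonneg_left (by omega) hab
  have h4 : a * b * (z' - z) ≤ a * b * (c - 1) := mul_le_mul_of_nonneg_left (by omega) hab
  rw [abs_lt]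
  constructor
  · have : -( (x - x') + a * (y - y') + a * b * (z - z')) = (x' - x) + a * (y' - y) + a * b * (z' - z) := by
      ring
    nlinarith
  · nlinarith

/-- Mixed-radix uniqueness: `(x − x') + a(y − y') + ab(z − z') = 0` with digits in range forces
`x = x'`, `y = y'`, `z = z'`. [bookkeeping] -/
theorem mixedRadix_eq_zero {a b x x' y y' z z' : ℤ} (hx : 0 ≤ x) (hxa : x < a) (hx' : 0 ≤ x')
    (hxa' : x' < a) (hy : 0 ≤ y) (hyb : y < b) (hy' : 0 ≤ y') (hyb' : y' < b)
    (h : (x - x') + a * (y - y') + a * b * (z - z') = 0) : x = x' ∧ y = y' ∧ z = z' := by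
  have ha : 0 < a := lt_of_le_of_lt hx hxa
  have hb : 0 < b := lt_of_le_of_lt hy hyb
  -- `a ∣ x - x'` and `|x - x'| < a`
  have hdx : a ∣ (x - x') := ⟨-((y - y') + b * (z - z')), by linear_combination h⟩
  have hx0 : x - x' = 0 := Int.eq_zero_of_abs_lt_dvd hdx (by rw [abs_lt]; constructor <;> omega)
  have hxx : x = x' := by omega
  -- then `b ∣ y - y'` and `|y - y'| < b`
  have h2 : a * ((y - y') + b * (z - z')) = 0 := by linear_combination h - hx0
  have h3 : (y - y') + b * (z - z') = 0 := by
    rcases mul_eq_zero.mp h2 with h | h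
    · exact absurd h ha.ne'
    · exact h
  have hdy : b ∣ (y - y') := ⟨-(z - z'), by linear_combination h3⟩
  have hy0 : y - y' = 0 := Int.eq_zero_of_abs_lt_dvd hdy (by rw [abs_lt]; constructor <;> omega)
  have hyy : y = y' := by omega
  have h4 : b * (z - z') = 0 := by linear_combination h3 - hy0
  have hzz : z = z' := by
    rcases mul_eq_zero.mp h4 with h | h
    · exact absurd h hb.ne'
    · omega
  exact ⟨hxx, hyy, hzz⟩

variable {n a b c : ℕ}

/-- Membership in `A`. [bookkeeping] -/
theorem mem_boxA {s : ZMod n} :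
    s ∈ ((range a).image fun x : ℕ => (x : ZMod n)) ↔ ∃ x : ℕ, x < a ∧ (x : ZMod n) = s := by
  simp

/-- Membership in `B`. [bookkeeping] -/
theorem mem_boxB {s : ZMod n} :
    s ∈ ((range b).image fun y : ℕ => ((a * y : ℕ) : ZMod n)) ↔
      ∃ y : ℕ, y < b ∧ ((a * y : ℕ) : ZMod n) = s := by
  simp

/-- Membership in `C`. [bookkeeping] -/
theorem mem_boxC {s : ZMod n} :
    s ∈ ((range c).image fun z : ℕ => ((a * b * z : ℕ) : ZMod n)) ↔
      ∃ z : ℕ, z < c ∧ ((a * b * z : ℕ) : ZMod n) = s := by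
  simp

/-- The key cast computation: a signed combination of box elements and multiples of `V = abc` is the
residue of an explicit integer. [bookkeeping] -/
theorem cast_combination (x x' y y' z z' : ℕ) (e f : ℤ) :
    ((x' : ZMod n) - (x : ZMod n)) + ((((a * y' : ℕ) : ZMod n)) - ((a * y : ℕ) : ZMod n))
      + ((((a * b * z' : ℕ) : ZMod n)) - ((a * b * z : ℕ) : ZMod n))
      + ((e : ZMod n) * ((a * b * c : ℕ) : ZMod n) + (f : ZMod n) * ((a * b * c : ℕ) : ZMod n)) =
    ((((x' : ℤ) - x) + (a : ℤ) * ((y' : ℤ) - y) + (a : ℤ) * b * ((z' : ℤ) - z)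
        + (e + f) * ((a : ℤ) * b * c) : ℤ) : ZMod n) := by
  push_cast; ring

/-- In `ℤ/n` with `n ≥ 3abc`: an integer `D` with `|D| < abc`, shifted by `kV` with `k ∈ {0, ±1, ±2}`
(`V = abc`), is `0 (mod n)` only if `D = 0` and `k = 0`. [bookkeeping] -/
theorem int_shift_ne_zero (hn : 3 * (a * b * c) ≤ n) {D k : ℤ} (hD : |D| < (a : ℤ) * b * c)
    (hk : k = 0 ∨ k = 1 ∨ k = -1 ∨ k = 2 ∨ k = -2)
    (h0 : ((D + k * ((a : ℤ) * b * c) : ℤ) : ZMod n) = 0) : D = 0 ∧ k = 0 := by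
  have hV : (0 : ℤ) < (a : ℤ) * b * c := lt_of_le_of_lt (abs_nonneg D) hD
  have hn' : (3 : ℤ) * ((a : ℤ) * b * c) ≤ (n : ℤ) := by exact_mod_cast hn
  haveI : NeZero n := ⟨by
    intro h; subst h; push_cast at hn'; linarith⟩
  rw [ZMod.intCast_zmod_eq_zero_iff_dvd] at h0
  rw [abs_lt] at hD
  have hsmall : |D + k * ((a : ℤ) * b * c)| < (n : ℤ) := by
    rw [abs_lt]; rcases hk with rfl | rfl | rfl | rfl | rfl <;> constructor <;> nlinarith
  have hzero := Int.eq_zero_of_abs_lt_dvd h0 hsmall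
  rcases hk with rfl | rfl | rfl | rfl | rfl
  · exact ⟨by simpa using hzero, rfl⟩
  all_goals exfalso; nlinarith

/-- **The box has the triple product property** in `ℤ/n` as soon as `n ≥ 3abc` (indeed `n ≥ abc` would do):
`IsSTPP ![A] ![B] ![C]`. [original] -/
theorem isSTPP_box (hn : 3 * (a * b * c) ≤ n) :
    IsSTPP ![((range a).image fun x : ℕ => (x : ZMod n))]
      ![((range b).image fun y : ℕ => ((a * y : ℕ) : ZMod n))]
      ![((range c).image fun z : ℕ => ((a * b * z : ℕ) : ZMod n))] := by
  intro i j k s hs s' hs' t ht t' ht' u hu u' hu' hrel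
  have hi : i = 0 := Subsingleton.elim _ _
  have hj : j = 0 := Subsingleton.elim _ _
  have hk : k = 0 := Subsingleton.elim _ _
  subst hi hj hk
  simp only [Fin.isValue, Matrix.cons_val_fin_one] at hs hs' ht ht' hu hu'
  obtain ⟨x, hxa, rfl⟩ := mem_boxA.1 hs
  obtain ⟨x', hxa', rfl⟩ := mem_boxA.1 hs'
  obtain ⟨y, hyb, rfl⟩ := mem_boxB.1 ht
  obtain ⟨y', hyb', rfl⟩ := mem_boxB.1 ht'
  obtain ⟨z, hzc, rfl⟩ := mem_boxC.1 hu
  obtain ⟨z', hzc', rfl⟩ := mem_boxC.1 hu'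
  have hcomb := cast_combination (n := n) (a := a) (b := b) (c := c) x x' y y' z z' 0 0
  simp only [Int.cast_zero, zero_mul, add_zero] at hcomb
  rw [hcomb] at hrel
  have hD := abs_mixedRadix_lt (a := (a : ℤ)) (b := b) (c := c) (x := (x' : ℤ)) (x' := x) (y := (y' : ℤ))
    (y' := y) (z := (z' : ℤ)) (z' := z) (by positivity) (by exact_mod_cast hxa') (by positivity)
    (by exact_mod_cast hxa) (by positivity) (by exact_mod_cast hyb') (by positivity) (by exact_mod_cast hyb)
    (by positivity) (by exact_mod_cast hzc') (by positivity) (by exact_mod_cast hzc)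
  have h00 := int_shift_ne_zero hn (k := 0) hD (Or.inl rfl) (by simpa using hrel)
  obtain ⟨hxx, hyy, hzz⟩ := mixedRadix_eq_zero (a := (a : ℤ)) (b := b) (by positivity)
    (by exact_mod_cast hxa') (by positivity) (by exact_mod_cast hxa) (by positivity) (by exact_mod_cast hyb')
    (by positivity) (by exact_mod_cast hyb) h00.1
  refine ⟨rfl, rfl, ?_, ?_, ?_⟩
  · have : x = x' := by exact_mod_cast hxx.symm
    rw [this]
  · have : y = y' := by exact_mod_cast hyy.symm
    rw [this]
  · have : z = z' := by exact_mod_cast hzz.symm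
    rw [this]

/-- **The cyclic translate pair is an STPP family**: for `n ≥ 3abc` the two triples `(A, B, C)` and
`(A, B + V, C + 2V)` (`V = abc`) in `ℤ/n` satisfy `IsSTPP`. [original] -/
theorem isSTPP_cyclicTranslatePair (hn : 3 * (a * b * c) ≤ n) :
    IsSTPP (fun _ : Fin 2 => ((range a).image fun x : ℕ => (x : ZMod n)))
      (fun t => (![0, ((a * b * c : ℕ) : ZMod n)] : Fin 2 → ZMod n) t +ᵥ
        ((range b).image fun y : ℕ => ((a * y : ℕ) : ZMod n)))
      (fun t => (![0, 2 * ((a * b * c : ℕ) : ZMod n)] : Fin 2 → ZMod n) t +ᵥ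
        ((range c).image fun z : ℕ => ((a * b * z : ℕ) : ZMod n))) := by
  refine STPPExistenceDesigns.isSTPP_translates _ _ _ (isSTPP_box hn)
    ((![0, ((a * b * c : ℕ) : ZMod n)] : Fin 2 → ZMod n)) ((![0, 2 * ((a * b * c : ℕ) : ZMod n)] : Fin 2 → ZMod n)) ?_
  intro i j k hijk d hd hzero
  -- unpack `d ∈ (A − A) + ((B − B) + (C − C))`
  obtain ⟨p, hp, q, hq, rfl⟩ := Finset.mem_add.1 hd
  obtain ⟨s', hs', s, hs, rfl⟩ := Finset.mem_sub.1 hp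
  obtain ⟨q₁, hq₁, q₂, hq₂, rfl⟩ := Finset.mem_add.1 hq
  obtain ⟨t', ht', t, ht, rfl⟩ := Finset.mem_sub.1 hq₁
  obtain ⟨u', hu', u, hu, rfl⟩ := Finset.mem_sub.1 hq₂
  obtain ⟨x, hxa, rfl⟩ := mem_boxA.1 hs
  obtain ⟨x', hxa', rfl⟩ := mem_boxA.1 hs'
  obtain ⟨y, hyb, rfl⟩ := mem_boxB.1 ht
  obtain ⟨y', hyb', rfl⟩ := mem_boxB.1 ht'
  obtain ⟨z, hzc, rfl⟩ := mem_boxC.1 hu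
  obtain ⟨z', hzc', rfl⟩ := mem_boxC.1 hu'
  have hD := abs_mixedRadix_lt (a := (a : ℤ)) (b := b) (c := c) (x := (x' : ℤ)) (x' := x) (y := (y' : ℤ))
    (y' := y) (z := (z' : ℤ)) (z' := z) (by positivity) (by exact_mod_cast hxa') (by positivity)
    (by exact_mod_cast hxa) (by positivity) (by exact_mod_cast hyb') (by positivity) (by exact_mod_cast hyb)
    (by positivity) (by exact_mod_cast hzc') (by positivity) (by exact_mod_cast hzc)
  -- the six cross patterns: the label offset is `e·V + f·V` with `(e, f)` read off from `(i, j, k)`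
  have key : ∀ e f : ℤ, (e + f = 1 ∨ e + f = -1 ∨ e + f = 2 ∨ e + f = -2) →
      ((x' : ZMod n) - (x : ZMod n)) + ((((a * y' : ℕ) : ZMod n)) - ((a * y : ℕ) : ZMod n)
        + ((((a * b * z' : ℕ) : ZMod n)) - ((a * b * z : ℕ) : ZMod n)))
        + ((e : ZMod n) * ((a * b * c : ℕ) : ZMod n) + (f : ZMod n) * ((a * b * c : ℕ) : ZMod n)) ≠ 0 := by
    intro e f hef h0
    have h1 : ((((x' : ℤ) - x) + (a : ℤ) * ((y' : ℤ) - y) + (a : ℤ) * b * ((z' : ℤ) - z)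
        + (e + f) * ((a : ℤ) * b * c) : ℤ) : ZMod n) = 0 := by
      rw [← cast_combination (n := n) (a := a) (b := b) (c := c) x x' y y' z z' e f, ← h0]; ring
    have := int_shift_ne_zero hn (k := e + f) hD (Or.inr hef) h1
    rcases hef with h | h | h | h <;> rw [h] at this <;> norm_num at this
  fin_cases i <;> fin_cases j <;> fin_cases k
  · exact hijk ⟨rfl, rfl⟩
  · -- (0,0,1): offset `2V`
    refine key 0 2 (by norm_num) ?_
    simpa [two_mul] using hzero
  · -- (0,1,0): offset `V − 2V`
    refine key 1 (-2) (by norm_num) ?_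
    simpa [two_mul, sub_eq_add_neg] using hzero
  · -- (0,1,1): offset `V`
    refine key 1 0 (by norm_num) ?_
    simpa using hzero
  · -- (1,0,0): offset `−V`
    refine key (-1) 0 (by norm_num) ?_
    simpa [sub_eq_add_neg] using hzero
  · -- (1,0,1): offset `−V + 2V`
    refine key (-1) 2 (by norm_num) ?_
    simpa [two_mul, sub_eq_add_neg] using hzero
  · -- (1,1,0): offset `−2V`
    refine key 0 (-2) (by norm_num) ?_
    simpa [two_mul, sub_eq_add_neg] using hzero
  · exact hijk ⟨rfl, rfl⟩

/-! ## Cardinalities and the existential statements -/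

/-- Casting `ℕ → ℤ/n` is injective below `n`. [bookkeeping] -/
theorem natCast_injOn_of_lt {m m' : ℕ} (hm : m < n) (hm' : m' < n) (h : (m : ZMod n) = (m' : ZMod n)) :
    m = m' := by
  have := (ZMod.natCast_eq_natCast_iff' m m' n).1 h
  rwa [Nat.mod_eq_of_lt hm, Nat.mod_eq_of_lt hm'] at this

/-- `|A| = a` (when `3abc ≤ n` and `b, c ≥ 1`, so that `a ≤ n`). [bookkeeping] -/
theorem card_boxA (hb : 0 < b) (hc : 0 < c) (hn : 3 * (a * b * c) ≤ n) :
    (((range a).image fun x : ℕ => (x : ZMod n))).card = a := by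
  have han : a ≤ n := by nlinarith [Nat.mul_le_mul (Nat.mul_le_mul (le_refl a) hb) hc]
  rw [card_image_of_injOn, card_range]
  intro x hx x' hx' h
  simp only [coe_range, Set.mem_Iio] at hx hx'
  exact natCast_injOn_of_lt (by omega) (by omega) h

/-- `|B| = b`. [bookkeeping] -/
theorem card_boxB (ha : 0 < a) (hc : 0 < c) (hn : 3 * (a * b * c) ≤ n) :
    (((range b).image fun y : ℕ => ((a * y : ℕ) : ZMod n))).card = b := by
  rw [card_image_of_injOn, card_range]
  intro y hy y' hy' h
  simp only [coe_range, Set.mem_Iio] at hy hy'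
  have h1 : a * y < n := by nlinarith [Nat.mul_lt_mul_of_pos_left hy ha]
  have h2 : a * y' < n := by nlinarith [Nat.mul_lt_mul_of_pos_left hy' ha]
  have := natCast_injOn_of_lt h1 h2 h
  exact Nat.eq_of_mul_eq_mul_left ha this

/-- `|C| = c`. [bookkeeping] -/
theorem card_boxC (ha : 0 < a) (hb : 0 < b) (hn : 3 * (a * b * c) ≤ n) :
    (((range c).image fun z : ℕ => ((a * b * z : ℕ) : ZMod n))).card = c := by
  rw [card_image_of_injOn, card_range]
  intro z hz z' hz' h
  simp only [coe_range, Set.mem_Iio] at hz hz'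
  have hab : 0 < a * b := Nat.mul_pos ha hb
  have h1 : a * b * z < n := by nlinarith [Nat.mul_lt_mul_of_pos_left hz hab]
  have h2 : a * b * z' < n := by nlinarith [Nat.mul_lt_mul_of_pos_left hz' hab]
  have := natCast_injOn_of_lt h1 h2 h
  exact Nat.eq_of_mul_eq_mul_left hab this

/-- **Every cyclic group of order `n ≥ 3abc` hosts an STPP pair of shapes `(a,b,c), (a,b,c)`**
(`a, b, c ≥ 1`). [original] -/
theorem exists_isSTPP_pair_zmod (ha : 0 < a) (hb : 0 < b) (hc : 0 < c) (hn : 3 * (a * b * c) ≤ n) :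
    ∃ A B C : Fin 2 → Finset (ZMod n), IsSTPP A B C ∧
      ∀ t, (A t).card = a ∧ (B t).card = b ∧ (C t).card = c := by
  refine ⟨fun _ => ((range a).image fun x : ℕ => (x : ZMod n)),
    fun t => (![0, ((a * b * c : ℕ) : ZMod n)] : Fin 2 → ZMod n) t +ᵥ
      ((range b).image fun y : ℕ => ((a * y : ℕ) : ZMod n)),
    fun t => (![0, 2 * ((a * b * c : ℕ) : ZMod n)] : Fin 2 → ZMod n) t +ᵥ
      ((range c).image fun z : ℕ => ((a * b * z : ℕ) : ZMod n)),
    isSTPP_cyclicTranslatePair hn, fun t => ⟨?_, ?_, ?_⟩⟩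
  · exact card_boxA hb hc hn
  · rw [card_vadd_finset]; exact card_boxB ha hc hn
  · rw [card_vadd_finset]; exact card_boxC ha hb hn

/-- **`ℤ/n` hosts an STPP pair of two `(s,s,s)` cubes whenever `n ≥ 3s³`** (`s ≥ 1`): the existence upper
end `E₂^{cyc}(s) ≤ 3s³` of the cell's table; the exact engine finds no cyclic host below `3s³` for `s ≤ 3`.
[original] -/
theorem exists_isSTPP_cube_pair_zmod {s : ℕ} (hs : 0 < s) (hn : 3 * s ^ 3 ≤ n) :
    ∃ A B C : Fin 2 → Finset (ZMod n), IsSTPP A B C ∧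
      ∀ t, (A t).card = s ∧ (B t).card = s ∧ (C t).card = s := by
  have h : 3 * (s * s * s) ≤ n := by
    have : s ^ 3 = s * s * s := by ring
    rw [this] at hn; exact hn
  exact exists_isSTPP_pair_zmod hs hs hs h

end Summit.MatrixMultiplication.MatrixMultiplication.Theorems.STPPCyclicTranslatePair
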